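import Summits.AtomisticToContinuum.Crystallization.Theses.ThreeConeCertificate
import Summits.AtomisticToContinuum.Crystallization.Theorems.ChargedEnergyGap.Negative.BlocksBound
import Summits.AtomisticToContinuum.Crystallization.Theorems.ChargedEnergyGap.Negative.Periodisation

/-!
# `ExactCertificate` (stmt-AtomisticToContinuum-11959), negative side I: splits and the value floor

Structural lemmas for the crux `ThreeConeCertificate.ExactCertificate` (refuter, cdisprove seat,
cycle 1).  `IsSplit ρ c g U f` packages the five cone conditions (S1)–(S5) of the crux (split
`V_LJ = g + U + f` on `(0,∞)`, `U ≥ 0`, `g ≡ 0` on `[ρ,∞)`, `f` radially of positive type, `g`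
`c`-stable).  Results:

* necessary conditions on ANY split: `c ≥ 0`, `f 0 ≥ 0`, `|f r| ≤ f 0`, `f = V_LJ − U ≤ V_LJ` on
  the tail, `0 < f 0` (the Bochner cone is necessarily charged), the finite-`N` certificate bound
  `−(c + f 0/2)·N ≤ E_LJ(x)` (`IsSplit.kepler`), the many-point Bochner budget
  `−2E_LJ(y) ≤ n·f 0` for `ρ`-separated `y`, and the **value floor `−e* ≤ c + f 0/2`**
  (`e* = ⨅_Q e_LJ(Q)`; no three-cone split at any range beats the periodic infimum);
* part II (`Factorisation`) draws the consequences for witnesses.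

All `[folklore]` (elementary consequences of the tree's trial states and periodisation).
-/

noncomputable section

namespace Summit.AtomisticToContinuum.Crystallization.Theorems.ExactCertificateNegative

open Literature.MathematicalPhysics.StatisticalMechanics
open Summit.AtomisticToContinuum.Crystallization.Theses.ThreeConeCertificate
open Summit.AtomisticToContinuum.Crystallization.Theorems.ChargedEnergyGapNegative
  (E3 eStar card_mul_eStar_le_interactionEnergy bddBelow_energyPerParticle_lennardJones
    exists_trialState eStar_le le_energyPerParticle_of_tendsto)
open Filter Topology
open scoped BigOperators

/-! ## The crux, parametrised -/

/-- The five cone conditions (S1)–(S5) on a split `(ρ, c, g, U, f)` of the Lennard-Jones potential: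
everything in the crux except the periodic configuration and the value equation (S6). [folklore] -/
def IsSplit (ρ c : ℝ) (g U f : ℝ → ℝ) : Prop :=
  (∀ r : ℝ, 0 < r → lennardJones r = g r + U r + f r) ∧
  (∀ r : ℝ, 0 < r → 0 ≤ U r) ∧
  (∀ r : ℝ, ρ ≤ r → g r = 0) ∧
  (∀ (n : ℕ) (y : Fin n → E3) (w : Fin n → ℝ), 0 ≤ ∑ i, ∑ j, w i * w j * f (dist (y i) (y j))) ∧
  (∀ (N : ℕ) (x : Fin N → E3), Function.Injective x → -(c * (N : ℝ)) ≤ interactionEnergy g x)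

/-- `ExactCertificate ↔ ∃ P ρ c g U f, IsSplit ρ c g U f ∧ c + f 0 / 2 = −e(P)`. [folklore] -/
theorem exactCertificate_iff :
    ExactCertificate ↔ ∃ (P : PeriodicConfiguration 3) (ρ c : ℝ) (g U f : ℝ → ℝ),
      IsSplit ρ c g U f ∧ c + f 0 / 2 = -(P.energyPerParticle lennardJones) := by
  constructor
  · rintro ⟨P, ρ, c, g, U, f, h1, h2, h3, h4, h5, h6⟩
    exact ⟨P, ρ, c, g, U, f, ⟨h1, h2, h3, h4, h5⟩, h6⟩
  · rintro ⟨P, ρ, c, g, U, f, ⟨h1, h2, h3, h4, h5⟩, h6⟩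
    exact ⟨P, ρ, c, g, U, f, h1, h2, h3, h4, h5, h6⟩

/-! ## Elementary tools -/

/-- The point `t·e₀` on the first axis. [folklore] -/
def ax (t : ℝ) : E3 := EuclideanSpace.single 0 t

/-- Distances on the first axis. [folklore] -/
theorem dist_ax (s t : ℝ) : dist (ax s) (ax t) = |s - t| := by
  rw [← Real.dist_eq]
  simp [ax]

/-- The full double sum of a radial kernel splits into the diagonal and twice the pair energy.
[folklore] -/
theorem sum_sum_eq (F : ℝ → ℝ) {N : ℕ} (x : Fin N → E3) :
    ∑ i, ∑ j, F (dist (x i) (x j)) = N * F 0 + 2 * interactionEnergy F x := by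
  rw [two_mul_interactionEnergy]
  have h : ∀ i : Fin N, ∑ j, F (dist (x i) (x j)) = F 0 + siteEnergy F x i := fun i => by
    rw [siteEnergy, ← Finset.add_sum_erase Finset.univ _ (Finset.mem_univ i), dist_self]
  simp only [h, Finset.sum_add_distrib, Finset.sum_const, Finset.card_univ, Fintype.card_fin,
    nsmul_eq_mul]

/-- The interaction energy is additive in the potential. [folklore] -/
theorem interactionEnergy_add (V W : ℝ → ℝ) {N : ℕ} (x : Fin N → E3) :
    interactionEnergy (fun r => V r + W r) x = interactionEnergy V x + interactionEnergy W x := by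
  simp only [interactionEnergy, Finset.sum_add_distrib]

/-- Two potentials that agree on `(0,∞)` have the same energy on injective configurations.
[folklore] -/
theorem interactionEnergy_congr_pos {V W : ℝ → ℝ} (h : ∀ r, 0 < r → V r = W r) {N : ℕ}
    {x : Fin N → E3} (hx : Function.Injective x) :
    interactionEnergy V x = interactionEnergy W x := by
  unfold interactionEnergy
  refine Finset.sum_congr rfl fun i _ => Finset.sum_congr rfl fun j hj => h _ ?_
  exact dist_pos.2 fun heq => (Finset.mem_Ioi.1 hj).ne' (hx heq.symm)

/-- A potential non-negative on `(0,∞)` has non-negative energy on injective configurations.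
[folklore] -/
theorem interactionEnergy_nonneg_of_pos {V : ℝ → ℝ} (h : ∀ r, 0 < r → 0 ≤ V r) {N : ℕ}
    {x : Fin N → E3} (hx : Function.Injective x) : 0 ≤ interactionEnergy V x := by
  unfold interactionEnergy
  refine Finset.sum_nonneg fun i _ => Finset.sum_nonneg fun j hj => h _ ?_
  exact dist_pos.2 fun heq => (Finset.mem_Ioi.1 hj).ne' (hx heq.symm)

/-! ## Necessary conditions on any split -/

namespace IsSplit

variable {ρ c : ℝ} {g U f : ℝ → ℝ}

/-- (S1). [folklore] -/
theorem split (h : IsSplit ρ c g U f) : ∀ r, 0 < r → lennardJones r = g r + U r + f r := h.1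

/-- (S2). [folklore] -/
theorem U_nonneg (h : IsSplit ρ c g U f) : ∀ r, 0 < r → 0 ≤ U r := h.2.1

/-- (S3). [folklore] -/
theorem g_zero (h : IsSplit ρ c g U f) : ∀ r, ρ ≤ r → g r = 0 := h.2.2.1

/-- (S4). [folklore] -/
theorem posType (h : IsSplit ρ c g U f) :
    ∀ (n : ℕ) (y : Fin n → E3) (w : Fin n → ℝ), 0 ≤ ∑ i, ∑ j, w i * w j * f (dist (y i) (y j)) :=
  h.2.2.2.1

/-- (S5). [folklore] -/
theorem stable (h : IsSplit ρ c g U f) :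
    ∀ (N : ℕ) (x : Fin N → E3), Function.Injective x → -(c * (N : ℝ)) ≤ interactionEnergy g x :=
  h.2.2.2.2

/-- Monotonicity in the range: a split of range `ρ` is a split of every larger range. [folklore] -/
theorem mono (h : IsSplit ρ c g U f) {ρ' : ℝ} (hρ : ρ ≤ ρ') : IsSplit ρ' c g U f :=
  ⟨h.1, h.2.1, fun r hr => h.g_zero r (hρ.trans hr), h.2.2.2.1, h.2.2.2.2⟩

/-- (N = 1) **`c ≥ 0`**: a single particle has zero `g`-energy. [folklore] -/
theorem c_nonneg (h : IsSplit ρ c g U f) : 0 ≤ c := by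
  have h1 := h.stable 1 (fun _ => 0) (fun i j _ => Subsingleton.elim i j)
  rw [interactionEnergy_of_subsingleton] at h1
  simpa using h1

/-- (n = 1) **`f 0 ≥ 0`**. [folklore] -/
theorem f_zero_nonneg (h : IsSplit ρ c g U f) : 0 ≤ f 0 := by
  have h1 := h.posType 1 (fun _ => 0) (fun _ => 1)
  simpa using h1

/-- The two-point quadratic form. [folklore] -/
theorem quad_two (f : ℝ → ℝ) (r s : ℝ) :
    ∑ i : Fin 2, ∑ j : Fin 2, (![1, s] i) * (![1, s] j) * f (dist ((![ax 0, ax r]) i) ((![ax 0, ax r]) j))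
      = (1 + s ^ 2) * f 0 + 2 * s * f |r| := by
  simp only [Fin.sum_univ_two, Matrix.cons_val_zero, Matrix.cons_val_one,
    dist_self, dist_ax, zero_sub, sub_zero, abs_neg]
  ring

/-- (n = 2) **`|f r| ≤ f 0`** for `r ≥ 0`. [folklore] -/
theorem abs_f_le (h : IsSplit ρ c g U f) {r : ℝ} (hr : 0 ≤ r) : |f r| ≤ f 0 := by
  have h1 := h.posType 2 ![ax 0, ax r] ![1, 1]
  have h2 := h.posType 2 ![ax 0, ax r] ![1, -1]
  rw [quad_two, abs_of_nonneg hr] at h1 h2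
  rw [abs_le]
  constructor <;> nlinarith

/-- On the tail `[ρ,∞) ∩ (0,∞)`: `f = V_LJ − U`. [folklore] -/
theorem f_eq_tail (h : IsSplit ρ c g U f) {r : ℝ} (hρ : ρ ≤ r) (hr : 0 < r) :
    f r = lennardJones r - U r := by
  have h1 := h.split r hr
  rw [h.g_zero r hρ] at h1
  linarith

/-- On the tail: **`f ≤ V_LJ`** (one-sided interpolation from below is forced). [folklore] -/
theorem f_le_tail (h : IsSplit ρ c g U f) {r : ℝ} (hρ : ρ ≤ r) (hr : 0 < r) :
    f r ≤ lennardJones r := by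
  have h1 := h.f_eq_tail hρ hr
  have h2 := h.U_nonneg r hr
  linarith

/-- Hence **`−V_LJ(r) ≤ f 0`** for every `r ≥ ρ`, `r > 0`. [folklore] -/
theorem neg_lennardJones_le_f_zero (h : IsSplit ρ c g U f) {r : ℝ} (hρ : ρ ≤ r) (hr : 0 < r) :
    -lennardJones r ≤ f 0 := by
  have h1 := h.f_le_tail hρ hr
  have h2 := h.abs_f_le hr.le
  rw [abs_le] at h2
  linarith [h2.1]

/-- **The Bochner cone is necessarily charged: `0 < f 0`** (test `r = max ρ 2`, where `V_LJ < 0`);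
the `ρ = ∞` collapse `g = V_LJ, U = f = 0` is unavailable at every real `ρ`. [folklore] -/
theorem f_zero_pos (h : IsSplit ρ c g U f) : 0 < f 0 := by
  have hr : (0 : ℝ) < max ρ 2 := lt_of_lt_of_le (by norm_num) (le_max_right _ _)
  have hV : lennardJones (max ρ 2) < 0 :=
    lennardJones_neg (lt_of_lt_of_le (by norm_num) (le_max_right _ _))
  have h1 := h.neg_lennardJones_le_f_zero (le_max_left _ _) hr
  linarith

/-- If the range is at most `1`, the Bochner cone pays at least the full well depth:
`f 0 ≥ 1/12 = −V_LJ(1)`. [folklore] -/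
theorem f_zero_ge_of_rho_le_one (h : IsSplit ρ c g U f) (hρ : ρ ≤ 1) : 1 / 12 ≤ f 0 := by
  have h1 := h.neg_lennardJones_le_f_zero hρ one_pos
  rw [lennardJones_one] at h1
  linarith

/-- The Bochner cone bound with unit weights: `−N·f 0/2 ≤ E_f(x)`. [folklore] -/
theorem f_energy_ge (h : IsSplit ρ c g U f) {N : ℕ} (x : Fin N → E3) :
    -((N : ℝ) * f 0 / 2) ≤ interactionEnergy f x := by
  have h1 := h.posType N x (fun _ => 1)
  simp only [one_mul] at h1
  rw [sum_sum_eq] at h1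
  linarith

/-- The slack cone: `0 ≤ E_U(x)` on injective configurations. [folklore] -/
theorem U_energy_nonneg (h : IsSplit ρ c g U f) {N : ℕ} {x : Fin N → E3}
    (hx : Function.Injective x) : 0 ≤ interactionEnergy U x :=
  interactionEnergy_nonneg_of_pos h.U_nonneg hx

/-- The three-cone decomposition of the Lennard-Jones energy of an injective configuration.
[folklore] -/
theorem energy_eq (h : IsSplit ρ c g U f) {N : ℕ} {x : Fin N → E3} (hx : Function.Injective x) :
    interactionEnergy lennardJones x =
      interactionEnergy g x + interactionEnergy U x + interactionEnergy f x := by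
  rw [interactionEnergy_congr_pos h.split hx, interactionEnergy_add, interactionEnergy_add]

/-- **The finite-N certificate bound** (mechanism of item 11962 CertificateBound, for ANY split,
no `P`): `−(c + f 0/2)·N ≤ E_LJ(x)` for every injective `x`. [folklore] -/
theorem kepler (h : IsSplit ρ c g U f) {N : ℕ} {x : Fin N → E3} (hx : Function.Injective x) :
    -((c + f 0 / 2) * N) ≤ interactionEnergy lennardJones x := by
  rw [h.energy_eq hx]
  have h1 := h.stable N x hx
  have h2 := h.U_energy_nonneg hx
  have h3 := h.f_energy_ge x
  nlinarith

/-- **THE VALUE FLOOR: `−e* ≤ c + f 0 / 2` for every split at every range** (finite trial states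
approach `e* = ⨅_Q e_LJ(Q)` from above).  The three-cone programme has value `≥ −e*`: (S6) can
only be attained, never beaten. [folklore] -/
theorem value_ge (h : IsSplit ρ c g U f) : -eStar ≤ c + f 0 / 2 := by
  by_contra hlt
  push Not at hlt
  obtain ⟨N, y, hN, hy, hE⟩ := exists_trialState (show 0 < -(c + f 0 / 2) - eStar by linarith)
  have h1 := h.kepler hy
  have h2 : (N : ℝ) * (eStar + (-(c + f 0 / 2) - eStar)) = -((c + f 0 / 2) * N) := by ring
  linarith

/-- **Many-point Bochner budget**: for an injective configuration `y` all of whose pair distances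
are `≥ ρ`, `−2·E_LJ(y) ≤ n·f 0` — the Bochner cone alone pays twice the binding energy of every
`ρ`-separated cluster. [folklore] -/
theorem binding_le (h : IsSplit ρ c g U f) {n : ℕ} {y : Fin n → E3} (hy : Function.Injective y)
    (hsep : ∀ i j, i ≠ j → ρ ≤ dist (y i) (y j)) :
    -(2 * interactionEnergy lennardJones y) ≤ n * f 0 := by
  have h1 := h.posType n y (fun _ => 1)
  simp only [one_mul] at h1
  rw [sum_sum_eq] at h1
  have h2 : interactionEnergy f y ≤ interactionEnergy lennardJones y := by
    unfold interactionEnergy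
    refine Finset.sum_le_sum fun i _ => Finset.sum_le_sum fun j hj => ?_
    have hij : i ≠ j := (Finset.mem_Ioi.1 hj).ne
    exact h.f_le_tail (hsep i j hij) (dist_pos.2 fun heq => hij (hy heq))
  linarith

end IsSplit

end Summit.AtomisticToContinuum.Crystallization.Theorems.ExactCertificateNegative

end
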